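import Literature.MathematicalPhysics.QuantumLattice.SpinSystem
import Literature.MathematicalPhysics.QuantumLattice.HeisenbergModel
import Literature.MathematicalPhysics.QuantumLattice.LocalDynamics
import Literature.MathematicalPhysics.QuantumLattice.InfiniteVolumeStates
import Literature.Probability.LatticeModels.CorrelationDecay
import Literature.Probability.LatticeModels.LatticeGraph
import HarnessLib
import HarnessLib.Audit

-- provenance: harness21/H21/H21/Statements/Hubbard/InfiniteVolume.lean @ 966583b (interim HEAD d8f2665); M5 mechanical rewrite
/-!
# Infinite-volume ground states of Heisenberg chains (family `hubbard`, S22–S23)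

Trunk QLatticeAQFT / family `hubbard`, statements **hubbard.S22** (the infinite-volume framework:
ground states and gapped ground states of the quasi-local spin algebra, definition role) and
**hubbard.S23** (the Haldane conjecture in infinite volume, and the Affleck–Lieb / Ogata–Tasaki
"no unique gapped ground state" theorem for half-odd-integer spin chains).

Contents (`namespace Literature.Hubbard`):

* `heisenbergInteraction n J : LatticeInteraction 1 (n + 1)`, the spin-`n/2` nearest-neighbour
  Heisenberg chain `H = J Σ_x 𝐒_x · 𝐒_{x+1}` on `ℤ` as a lattice interaction
  (`Φ {x, x+1} = J 𝐒_x · 𝐒_{x+1}`, `Φ X = 0` otherwise), with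
  `hasFiniteRange_heisenbergInteraction` (range `1`, proved), `isHermitian_heisenbergInteraction`
  (proved), `isTranslationInvariant_heisenbergInteraction` (named fact, discharged by
  `isTranslationInvariant_heisenbergInteraction_holds` via the transport lemmas
  `transportOp_onSite`, `transportOp_spinDot`);
* **hubbard.S22**: `isGroundState_of_boxGroundStates` (thermodynamic limits of finite-volume
  ground states are infinite-volume ground states, re-exported from the prelude in `groundStates`
  form, plus the chain specialisation `mem_groundStates_heisenbergInteraction_of_boxGroundStates`)
  and `isGappedGroundState_iff_local_gap_inequality` (the local gap criterion only needs to be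
  checked on local observables `A` with `ω(A) = 0`);
* **hubbard.S23**: `HaldaneConjectureInfVol` (open; `def … : Prop`) and the theorem
  `no_unique_gapped_groundState_halfOddSpin` (Affleck–Lieb 1986, Tasaki 2018, Ogata–Tasaki 2019)
  with its corollary `not_hasUniqueGappedGroundState_halfOddSpin`.

## Sources

* O. Bratteli, D. W. Robinson, *Operator Algebras and Quantum Statistical Mechanics II* (2nd ed.,
  1997), §5.3.1 (ground states, Def. 5.3.18, Prop. 5.3.19), §6.2 (quantum spin systems).
* H. Tasaki, *Physics and Mathematics of Quantum Many-Body Systems* (Springer 2020), App. A.7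
  (Def. A.14–A.16, Lemma A.15, Lemma A.17), Ch. 8 (Haldane phenomena).
* I. Affleck, E. H. Lieb, *A proof of part of Haldane's conjecture on spin chains*,
  Lett. Math. Phys. 12 (1986) 57.
* H. Tasaki, *Lieb–Schultz–Mattis theorem with a local twist for general one-dimensional
  quantum systems*, J. Stat. Phys. 170 (2018) 653.
* Y. Ogata, H. Tasaki, *Lieb–Schultz–Mattis type theorems for quantum spin chains without
  continuous symmetry*, Comm. Math. Phys. 372 (2019) 951, Theorem 1 / Corollary 2.
* F. D. M. Haldane, Phys. Lett. A 93 (1983) 464; Phys. Rev. Lett. 50 (1983) 1153.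

## Coverage of hubbard.S22 (honest record, review F12d)

The inventory text of S22 lists: the quasi-local algebra `𝔄`, the dynamics `τ_t`, states `ω`,
ground states `-i ω(A⋆δ(A)) ≥ 0`, the GNS triple `(H_ω, π_ω, Ω_ω)` with `H_ω ≥ 0`, and "unique
gapped ground state: `spec H_ω ⊆ {0} ∪ [γ, ∞)`". This file (tier M) covers, through the accepted
prelude `Literature.Prelude.QLatticeAQFT.InfiniteVolumeStates`, the parts expressible on the algebraic
inductive limit: states as compatible families (`InfVolState`), the derivation
`δ = i[H_{Λ_R}, ·]` (`derivation`), ground states (`InfVolState.IsGroundState`) and the *local*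
gap criterion `-i ω(A⋆δ(A)) ≥ γ (ω(A⋆A) - |ω(A)|²)` (`InfVolState.IsGappedGroundState`), which in
the GNS representation is `⟨ψ, H_ω ψ⟩ ≥ γ ‖(1 - |Ω⟩⟨Ω|)ψ‖²` on the core `π_ω(𝔄_loc)Ω`, i.e.
`ker H_ω = ℂΩ` and `spec H_ω ⊆ {0} ∪ [γ, ∞)` (Tasaki 2020, Def. A.16 and Lemma A.17). The **GNS
clause itself** (`H_ω ≥ 0` as a self-adjoint operator, its spectrum) and the notion
`cstar_state_gns` are **not** claimed here: they are covered only at tier L by the item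
`QuasiLocalAlgebra` (`exists_gnsHamiltonian`, `isGappedGroundState_iff_hasGroundStateGap`).

## Mathlib / H21 status and design choices

* Mathlib has no quantum spin chains, lattice interactions, infinite-volume states or Haldane-gap
  material (searched `Haldane`, `heisenberg`, `quasi.?local`, `groundState`: nothing relevant).
  Used from Mathlib: `Finset.card`, `Metric.diam`, `Complex` with `open scoped ComplexOrder`.
  Used from H21: `LatticeInteraction`, `LatticeInteraction.mk/HasFiniteRange/IsHermitian/
  IsTranslationInvariant`, `boxHamiltonian` (`LocalDynamics`); `spinDot` (`HeisenbergModel`);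
  `onSite`, `embedOp`, `Op`, `SpinSpace` (`SpinSystem`); `InfVolState`, `IsBoxLimitOf`, `corr`,
  `derivation`, `thicken`, `IsGroundState`, `IsGappedGroundState`, `groundStates`,
  `HasUniqueGroundState`, `HasUniqueGappedGroundState` (`InfiniteVolumeStates`);
  `StatMech.HasExponentialDecay`, `Site` (`CorrelationDecay`, `LatticeGraph`).
* `heisenbergInteraction` is written without choice: on `Site 1 = Fin 1 → ℤ` the lattice unit
  vector is the constant function `1`, and
  `Φ X = if #X = 2 then J Σ_{x,y ∈ X, y = x+1} 𝐒_x · 𝐒_y else 0`; the constrained double sum has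
  exactly one term when `X = {x, x+1}` and is `0` for any other two-element set.
* The infinite-volume statements use the range parameter `R = 1` of the prelude's `derivation`
  (the chain interaction has range `1`, `hasFiniteRange_heisenbergInteraction`).
* `HaldaneConjectureInfVol` is stated for `J = 1` (antiferromagnet; the sign of `J > 0` is a
  rescaling) as: the set of infinite-volume ground states is a singleton `{ω}`, `ω` is
  translation invariant, gapped for some `γ > 0`, and all truncated two-point functions of
  single-site observables decay exponentially (`truncatedCorr`; the prelude's `InfVolState.corr`
  is the two-site correlation API available at tier M — general local observables would need
  translates of local operators inside a common local algebra, which we do not introduce here).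
* `no_unique_gapped_groundState_halfOddSpin` is stated for every coupling `J` (Ogata–Tasaki's
  Theorem 1 covers all translation-invariant finite-range `U(1) ⋊ ℤ₂`-symmetric chains; for
  `J ≤ 0` the ground state is anyway not unique), slightly more general than the outline's `J > 0`.
-/

noncomputable section

open Filter Finset Matrix Complex
open scoped ComplexOrder
open Literature.MathematicalPhysics.QuantumLattice Literature.Probability.LatticeModels

namespace Literature.MathematicalPhysics.QuantumLattice

/-! ### The Heisenberg chain as a lattice interaction -/

/-- The spin-`n/2` nearest-neighbour **Heisenberg chain** `H = J Σ_{x ∈ ℤ} 𝐒_x · 𝐒_{x+1}` as an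
interaction on `ℤ = Site 1`: `Φ {x, x + 1} = J 𝐒_x · 𝐒_{x+1}` and `Φ X = 0` for every other finite
region. Written choice-free as `if #X = 2 then J Σ_{x, y ∈ X, y = x + 1} 𝐒_x · 𝐒_y else 0` (the
lattice unit vector of `Fin 1 → ℤ` is the constant `1`). Antiferromagnetic iff `0 < J`.
Bratteli–Robinson II §6.2.1, Example 6.2.3; Tasaki (2020) §2.4, eq. (2.4.1) and App. A.7.
[cite: Tasaki2020] -/
def heisenbergInteraction (n : ℕ) (J : ℝ) : LatticeInteraction 1 (n + 1) :=
  LatticeInteraction.mk fun X =>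
    if X.card = 2 then
      (J : ℂ) • ∑ x : ↥X, ∑ y : ↥X, if (y : Site 1) = (x : Site 1) + 1 then spinDot n x y else 0
    else 0

/-- Unfolding `heisenbergInteraction`. Tasaki (2020) §2.4. [cite: Tasaki2020] -/
theorem heisenbergInteraction_apply (n : ℕ) (J : ℝ) (X : Finset (Site 1)) :
    heisenbergInteraction n J X =
      if X.card = 2 then
        (J : ℂ) • ∑ x : ↥X, ∑ y : ↥X,
          if (y : Site 1) = (x : Site 1) + 1 then spinDot n x y else 0
      else 0 :=
  rfl

/-- The Heisenberg chain interaction has **finite range `1`**: `Φ X = 0` whenever `diam X > 1`.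
Bratteli–Robinson II §6.2.1 ("finite range"). [folklore] -/
theorem hasFiniteRange_heisenbergInteraction (n : ℕ) (J : ℝ) :
    (heisenbergInteraction n J).HasFiniteRange 1 := by
  intro X hX
  rw [heisenbergInteraction_apply]
  split_ifs with h2
  · rw [Finset.sum_eq_zero fun x _ => Finset.sum_eq_zero fun y _ => ?_, smul_zero]
    rw [if_neg]
    intro hxy
    have hdist : dist (x : Site 1) y = 1 := by
      rw [hxy, dist_eq_norm, sub_add_cancel_left, norm_neg, norm_one]
    have hne : (x : Site 1) ≠ y := fun h => by
      rw [h, dist_self] at hdist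
      exact zero_ne_one hdist
    have hXe : X = {(x : Site 1), (y : Site 1)} := by
      refine (Finset.eq_of_subset_of_card_le (fun z hz => ?_) ?_).symm
      · rcases Finset.mem_insert.1 hz with rfl | hz
        · exact x.2
        · rw [Finset.mem_singleton.1 hz]; exact y.2
      · rw [Finset.card_pair hne, h2]
    rw [hXe, Finset.coe_pair, Metric.diam_pair, hdist] at hX
    exact lt_irrefl _ hX
  · rfl

/-- The Heisenberg chain interaction is Hermitian (every term is self-adjoint).
Bratteli–Robinson II §6.2.1. [folklore] -/
theorem isHermitian_heisenbergInteraction (n : ℕ) (J : ℝ) :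
    (heisenbergInteraction n J).IsHermitian := by
  intro X
  rw [heisenbergInteraction_apply]
  split_ifs with h2
  · refine IsHermitian.smul ?_ ?_
    · rw [IsHermitian, conjTranspose_sum]
      refine Finset.sum_congr rfl fun x _ => ?_
      rw [conjTranspose_sum]
      refine Finset.sum_congr rfl fun y _ => ?_
      split_ifs
      · exact (spinDot_isHermitian n x y).eq
      · exact conjTranspose_zero
    · rw [isSelfAdjoint_iff, Complex.star_def, conj_ofReal]
  · exact isHermitian_zero

/-- The Heisenberg chain interaction is **translation invariant**: `Φ (X + v) = τ_v (Φ X)`.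
Kept as a named fact for importers; proved below as
`isTranslationInvariant_heisenbergInteraction_holds`.
Bratteli–Robinson II §6.2.1, eq. (6.2.3) (translation-covariant interactions) and Example 6.2.3.
[cite: BratteliRobinsonII1997, §6.2.1 eq. (6.2.3)] -/
def isTranslationInvariant_heisenbergInteraction : Prop :=
  ∀ (n : ℕ) (J : ℝ),
    (heisenbergInteraction n J).IsTranslationInvariant

section Transport

variable {X Y : Type*} [Fintype X] [DecidableEq X] [Fintype Y] [DecidableEq Y] {q : ℕ}

/-- `transportOp e` is Mathlib's reindexing algebra isomorphism `Matrix.reindexAlgEquiv` along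
`σ ↦ σ ∘ e⁻¹` (so it is additive, multiplicative and `ℂ`-linear). Bratteli–Robinson II §6.2.1
(covariance). [folklore] -/
theorem transportOp_eq_reindexAlgEquiv (e : X ≃ Y) (A : Matrix (X → Fin q) (X → Fin q) ℂ) :
    transportOp e A = Matrix.reindexAlgEquiv ℂ ℂ (e.arrowCongr (Equiv.refl (Fin q))) A :=
  rfl

/-- Transport along a relabelling `e : X ≃ Y` moves a single-site operator at `x` to the same
operator at `e x`: `τ_e (a_x) = a_{e x}`. Bratteli–Robinson II §6.2.1, eq. (6.2.2). [folklore] -/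
theorem transportOp_onSite (e : X ≃ Y) (x : X) (a : Matrix (Fin q) (Fin q) ℂ) :
    transportOp e (onSite x a) = onSite (e x) a := by
  ext σ τ
  simp only [transportOp, reindex_apply, submatrix_apply, onSite, of_apply,
    Equiv.arrowCongr_symm, Equiv.arrowCongr_apply, Equiv.refl_symm, Equiv.coe_refl,
    Function.comp_apply, Equiv.symm_symm]
  refine if_congr ⟨fun h y hy ↦ ?_, fun h y hy ↦ h _ fun h' ↦ hy (e.injective h')⟩ rfl rfl
  simpa using h (e.symm y) fun h' ↦ hy (by rw [← h', Equiv.apply_symm_apply])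

/-- Transport along `e : X ≃ Y` moves the exchange operator: `τ_e (𝐒_x · 𝐒_y) = 𝐒_{e x} · 𝐒_{e y}`.
Bratteli–Robinson II §6.2.1; Tasaki (2020) §2.4. [folklore] -/
theorem transportOp_spinDot (n : ℕ) (e : X ≃ Y) (x y : X) :
    transportOp e (spinDot n x y) = spinDot n (e x) (e y) := by
  simp only [transportOp_eq_reindexAlgEquiv, spinDot, spinBond, siteSpin, map_sum, map_smul,
    map_add, map_mul]
  simp only [← transportOp_eq_reindexAlgEquiv, transportOp_onSite]

end Transport

/-- Proof of the named fact `isTranslationInvariant_heisenbergInteraction`: the Heisenberg chain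
interaction is translation invariant (reindex the double sum along `finsetMapEquiv`, use
`(y + v) = (x + v) + 1 ↔ y = x + 1` and `transportOp_spinDot`).
Bratteli–Robinson II §6.2.1, eq. (6.2.3) and Example 6.2.3. [folklore] -/
theorem isTranslationInvariant_heisenbergInteraction_holds :
    isTranslationInvariant_heisenbergInteraction := by
  intro n J v X
  rw [heisenbergInteraction_apply, heisenbergInteraction_apply, card_map]
  split_ifs with h2
  · simp only [transportOp_eq_reindexAlgEquiv, map_smul, map_sum]
    congr 1
    rw [← (finsetMapEquiv (Site.shift v).toEmbedding X).sum_comp]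
    refine sum_congr rfl fun x _ ↦ ?_
    rw [← (finsetMapEquiv (Site.shift v).toEmbedding X).sum_comp]
    refine sum_congr rfl fun y _ ↦ ?_
    simp only [coe_finsetMapEquiv_apply, Equiv.coe_toEmbedding, Site.shift_apply,
      add_right_comm _ v, add_left_inj]
    split_ifs
    · rw [← transportOp_eq_reindexAlgEquiv, transportOp_spinDot]
    · rw [map_zero]
  · rw [transportOp_eq_reindexAlgEquiv, map_zero]

/-! ### hubbard.S22: infinite-volume ground states and the local gap criterion -/

section S22

variable {d q : ℕ}

/-- **hubbard.S22** (infinite-volume framework, ground-state part). Thermodynamic limits of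
finite-volume ground states are infinite-volume ground states: if `ψ_L` is a ground-state vector
of the box Hamiltonian `H_L = Σ_{X ⊆ Λ_L} Φ X` of a Hermitian interaction of finite range `R` for
every `L`, and `⟨ψ_L, (A ⊗ 𝟙) ψ_L⟩ → ω(A)` for every local `A`, then `ω ∈ groundStates Φ R`, i.e.
`-i ω(A⋆ δ(A)) ≥ 0` for all local `A` (re-export of the prelude's
`InfVolState.IsGroundState.of_isBoxLimitOf`). The GNS clause of S22 (`H_ω ≥ 0`,
`spec H_ω ⊆ {0} ∪ [γ, ∞)`) is covered only at tier L (`QuasiLocalAlgebra.exists_gnsHamiltonian`,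
`isGappedGroundState_iff_hasGroundStateGap`); this declaration does not claim it.
Tasaki (2020) App. A.7, Lemma A.15; Bratteli–Robinson II Prop. 5.3.25, §6.2.7. [cite: Tasaki2020] -/
def isGroundState_of_boxGroundStates : Prop :=
  ∀ {Φ : LatticeInteraction d q} {R : ℝ} (hΦ : Φ.HasFiniteRange R) (hH : Φ.IsHermitian)
    {ψ : ∀ L, SpinSpace ↥(box d L) q}
    (hψ : ∀ L, (boxHamiltonian Φ L).IsGroundStateVector (WithLp.ofLp (ψ L)))
    {ω : InfVolState d q} (hlim : ω.IsBoxLimitOf ψ),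
    ω ∈ groundStates Φ R

/- interim proof relied on results that are now named facts (D-0014); demoted to a fact by the M5
import, proof preserved:
:=
  InfVolState.IsGroundState.of_isBoxLimitOf hΦ hH hψ hlim
-/

/-- The chain case of `isGroundState_of_boxGroundStates`: box limits of ground-state vectors of
the open Heisenberg chains `H_L = J Σ_{x=-L}^{L-1} 𝐒_x · 𝐒_{x+1}` on `{-L, …, L}` are
infinite-volume ground states of `heisenbergInteraction n J` (range `1`).
Tasaki (2020) App. A.7, Lemma A.15. [cite: Tasaki2020] -/
def mem_groundStates_heisenbergInteraction_of_boxGroundStates : Prop :=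
  ∀ (n : ℕ) (J : ℝ) {ψ : ∀ L, SpinSpace ↥(box 1 L) (n + 1)}
    (hψ : ∀ L,
      (boxHamiltonian (heisenbergInteraction n J) L).IsGroundStateVector (WithLp.ofLp (ψ L)))
    {ω : InfVolState 1 (n + 1)} (hlim : ω.IsBoxLimitOf ψ),
    ω ∈ groundStates (heisenbergInteraction n J) 1

/- interim proof relied on results that are now named facts (D-0014); demoted to a fact by the M5
import, proof preserved:
:=
  isGroundState_of_boxGroundStates (hasFiniteRange_heisenbergInteraction n J)
    (isHermitian_heisenbergInteraction n J) hψ hlim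
-/

/-- **hubbard.S22** (infinite-volume framework, gapped ground states; unfolding lemma). An
infinite-volume state `ω` is a gapped ground state of `Φ` with gap `γ` (prelude
`InfVolState.IsGappedGroundState`: ground state, `0 < γ`, and
`-i ω(A⋆ δ(A)) ≥ γ (ω(A⋆A) - |ω(A)|²)` for all local `A`) iff it is a ground state, `0 < γ`, and
the **local gap inequality** `-i ω(A⋆ δ(A)) ≥ γ ω(A⋆A)` holds for all local `A` with `ω(A) = 0`
(replace `A` by `A - ω(A)𝟙`, using `δ(𝟙) = 0` and `ω(δ(A)) = 0` for ground states). In the GNS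
representation `ω(A⋆A) - |ω(A)|² = ‖(1 - |Ω⟩⟨Ω|) π(A)Ω‖²` and `-i ω(A⋆δ(A)) = ⟨π(A)Ω, H_ω π(A)Ω⟩`,
so this is `H_ω ≥ γ` on `Ω^⊥`, i.e. `spec H_ω ⊆ {0} ∪ [γ, ∞)` with `ker H_ω = ℂΩ`. **Honest
record:** the GNS objects `(H_ω, π_ω, Ω_ω)`, `H_ω ≥ 0` and the spectral formulation (notion
`cstar_state_gns`) are *not* formalised at this tier; they are covered only at tier L by
`QuasiLocalAlgebra.exists_gnsHamiltonian` / `isGappedGroundState_iff_hasGroundStateGap`.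
Tasaki (2020) App. A.7, Def. A.16 and Lemma A.17; Bratteli–Robinson II Prop. 5.3.19, §6.2.7.
[cite: Tasaki2020] -/
def isGappedGroundState_iff_local_gap_inequality : Prop :=
  ∀ {ω : InfVolState d q} {Φ : LatticeInteraction d q} (hΦ : Φ.IsHermitian) {R γ : ℝ},
    ω.IsGappedGroundState Φ R γ ↔
      ω.IsGroundState Φ R ∧ 0 < γ ∧
        ∀ (Λ : Finset (Site d)) (A : Op ↥Λ q), ω.expect Λ A = 0 →
          ((γ * (ω.expect Λ (Aᴴ * A)).re : ℝ) : ℂ) ≤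
            -I * ω.expect (thicken Λ R)
              ((embedOp (subset_thicken Λ R) A)ᴴ * derivation Φ R Λ A)

/- interim partial proof (harness21 @ d8f2665), preserved for route work:
:= by
  refine ⟨fun h => ⟨h.1, h.2.1, fun Λ A hA => ?_⟩, fun h => ⟨h.1, h.2.1, fun Λ A => ?_⟩⟩
  · simpa [hA] using h.2.2 Λ A
  · sorry
-/

end S22

/-! ### hubbard.S23: the Haldane conjecture in infinite volume -/

/-- The truncated two-point function `ω(a_0 b_x) - ω(a_0) ω(b_x)` of the single-site observables
`a` at the origin and `b` at `x`, for an infinite-volume state `ω` on `ℤ^d`.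
Tasaki (2020) App. A.7; Nachtergaele–Sims, CMP 265 (2006) §2 (exponential clustering).
[cite: Tasaki2020] -/
def truncatedCorr {d q : ℕ} (ω : InfVolState d q) (x : Site d) (a b : Matrix (Fin q) (Fin q) ℂ) :
    ℂ :=
  ω.corr 0 x a b -
    ω.expect {0} (onSite ⟨0, mem_singleton_self 0⟩ a) *
      ω.expect {x} (onSite ⟨x, mem_singleton_self x⟩ b)

/-- **hubbard.S23** (Haldane conjecture, infinite-volume form; **open**). The spin-`1`
antiferromagnetic Heisenberg chain `H = Σ_x 𝐒_x · 𝐒_{x+1}` on `𝔄 = ⊗_ℤ M₃` (here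
`heisenbergInteraction 2 1`, range `1`) has a unique infinite-volume ground state `ω`
(`groundStates = {ω}`, hence translation invariant), which is a gapped ground state for some
`γ > 0` (local gap criterion `InfVolState.IsGappedGroundState`, i.e. `spec H_ω ⊆ {0} ∪ [γ, ∞)` in
the GNS representation), and whose truncated correlations of single-site observables decay
exponentially. Stated as a `Prop`; not asserted. Haldane (1983); Affleck–Lieb, LMP 12 (1986);
Tasaki (2020) Ch. 8, Conjecture 8.1 (infinite-volume version, App. A.7). [cite: Haldane1983] -/
@[conjecture] def HaldaneConjectureInfVol : Prop :=
  ∃ ω : InfVolState 1 3,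
    groundStates (heisenbergInteraction 2 1) 1 = {ω} ∧ ω.IsTranslationInvariant ∧
      (∃ γ : ℝ, 0 < γ ∧ ω.IsGappedGroundState (heisenbergInteraction 2 1) 1 γ) ∧
        ∀ a b : Matrix (Fin 3) (Fin 3) ℂ,
          HasExponentialDecay (fun x : Site 1 => ‖truncatedCorr ω x a b‖)

/-- **hubbard.S23** (Affleck–Lieb / Ogata–Tasaki: no unique gapped ground state for
half-odd-integer spin). For the spin-`S` Heisenberg chain `H = J Σ_x 𝐒_x · 𝐒_{x+1}` with
`S = n/2` half-odd-integer (`n` odd) and any coupling `J`: if the infinite-volume ground state is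
unique, then it is not gapped — for every ground state `ω` and every `γ`, the local gap criterion
`IsGappedGroundState … γ` fails (equivalently, `0` is not an isolated simple point of `spec H_ω`).
Affleck–Lieb, LMP 12 (1986) 57, Theorem 2; Tasaki, J. Stat. Phys. 170 (2018) 653, Theorem;
Ogata–Tasaki, CMP 372 (2019) 951, Theorem 1 and Corollary 2 (general translation-invariant
finite-range `U(1) ⋊ ℤ₂`-invariant chains, any sign of `J`); Tasaki (2020) Thm. 8.5.
[cite: Tasaki2020] -/
def no_unique_gapped_groundState_halfOddSpin : Prop :=
  ∀ (n : ℕ) (hn : Odd n) (J : ℝ),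
    ∀ (ω : InfVolState 1 (n + 1)) (γ : ℝ),
      HasUniqueGroundState (heisenbergInteraction n J) 1 →
        ω ∈ groundStates (heisenbergInteraction n J) 1 →
          ¬ ω.IsGappedGroundState (heisenbergInteraction n J) 1 γ

/-- Corollary of `no_unique_gapped_groundState_halfOddSpin` in the prelude's vocabulary: a
half-odd-integer-spin Heisenberg chain does not have a unique gapped ground state
(`¬ HasUniqueGappedGroundState`). Ogata–Tasaki, CMP 372 (2019) 951, Corollary 2;
Tasaki (2020) Thm. 8.5. [cite: Tasaki2020] -/
def not_hasUniqueGappedGroundState_halfOddSpin : Prop :=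
  ∀ (n : ℕ) (hn : Odd n) (J : ℝ),
    ¬ HasUniqueGappedGroundState (heisenbergInteraction n J) 1

/- interim proof relied on results that are now named facts (D-0014); demoted to a fact by the M5
import, proof preserved:
:= by
  rintro ⟨huniq, ω, γ, hgap⟩
  exact no_unique_gapped_groundState_halfOddSpin n hn J ω γ huniq hgap.isGroundState hgap
-/

end Literature.MathematicalPhysics.QuantumLattice
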